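import Summits.QuantumFields.YangMills.Theorems.FradkinShenkerFlowSusceptibilityToPoincareJointMarginal
import Summits.QuantumFields.YangMills.Theorems.FradkinShenkerFlowSusceptibilityToPoincareLinkSetPoincare
import Summits.QuantumFields.YangMills.Theorems.FradkinShenkerFlowSusceptibilityToPoincareTwoBlockFactorization

/-!
# Rider `stub_pinnedGlauber_le_heatBath` (R_B) of the line `rg-variance-cascade`
(crux `SusceptibilityToPoincare`)

Route `FradkinShenkerFlow` of `YangMills`, crux item `stmt-QuantumFields-9441`
(`Summit.QuantumFields.YangMills.Theses.FradkinShenkerFlow.SusceptibilityToPoincare`, FS ⇒ UP),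
registered skeleton `Cruxes/SusceptibilityToPoincare/Lines/rg_variance_cascade.lean`, rider R_B:
**the pinned single-link conditional variances of the joint law are dominated by the Wilson
heat-bath form.**

For the 4D torus of side `2S+1`, the Wilson measure `μ = wilsonMeasure r.ρ β`, the joint law `P`
of the fine field `U` and its von Mises–Fisher-smeared block fields `V = (V^k)_{k<n}` (a
probability measure with `P.map Prod.fst = μ`, `stub_jointMarginal`) and a bounded measurable `F`:

  `Σ_ℓ ∫ (F∘fst − E_P[F∘fst | 𝓗_ℓ])² dP ≤ C · Σ_ℓ ∫∫ (F U − F(U[ℓ ↦ g]))² dν_ℓ^U(g) dμ(U)`,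

where `𝓗_ℓ = comap (ω ↦ (U[ℓ ↦ 1], V))` is the σ-algebra of everything except the fine link `ℓ`
(all other fine links AND all block fields), `ν_ℓ^U` is the one-link heat-bath law, and
`C = A · B` with the constants `A ≥ 0`, `B ≥ 1` of `stub_linkSetPoincare` (depending on `G, r, β`
only).

## Proof

Per link `ℓ`:
* *Projection inequality* (`PinnedGlauber.integral_sub_condExp_sq_le_integral_sub_sq`): on a
  finite measure space the `L²`-residual of `f` after conditioning on `m` is at most the
  `L²`-distance from `f` to ANY `m`-measurable `g ∈ L²` (Pythagoras; the cross term vanishes by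
  the pull-out property `TwoBlock.integral_condExp_mul`).
* *The approximant* `g = E_μ[F | cylinderEvents {ℓ}ᶜ] ∘ fst` is `𝓗_ℓ`-measurable, because
  `comap fst (cylinderEvents {ℓ}ᶜ) ≤ 𝓗_ℓ`: every coordinate `ω ↦ ω.1 ℓ'`, `ℓ' ≠ ℓ`, factors
  through the pinning map (`Function.update_of_ne`;
  `PinnedGlauber.comap_fst_cylinderEvents_le`).
* *Transfer* along `P.map fst = μ` (`integral_map`):
  `∫ (F∘fst − g)² dP = ∫ (F − E_μ[F | cylinderEvents {ℓ}ᶜ])² dμ`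
  (`PinnedGlauber.integral_sub_condExp_comp_sq_le`,
  `PinnedGlauber.integral_sub_condExp_pinned_sq_le`).
* *Single-link local Poincaré inequality*: the latter is `≤ A · B · hb_ℓ(F)` by
  `stub_linkSetPoincare` with `D = {ℓ}`.
Summing over `ℓ` gives the claim with `C = A · B`.
-/

noncomputable section

open MeasureTheory ProbabilityTheory
open Literature.MathematicalPhysics.QuantumFieldTheory

namespace Summit.QuantumFields.YangMills.Theorems.SusceptibilityToPoincare.RgVarianceCascade

namespace PinnedGlauber

/-! ### Abstract `L²` facts: the conditional expectation is the best `m`-measurable approximant -/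

section Projection

variable {Ω : Type*} {m m0 : MeasurableSpace Ω} {μ : Measure Ω} [IsFiniteMeasure μ]

/-- **Projection inequality.** On a finite measure space, for `m ≤ m0`, `f ∈ L²` and any
`m`-strongly-measurable `g ∈ L²`: `∫ (f − μ[f|m])² ≤ ∫ (f − g)²` — Pythagoras
`∫ (f − g)² = ∫ (f − μ[f|m])² + ∫ (μ[f|m] − g)²`, the cross term vanishing by the pull-out
property `∫ μ[f|m] w = ∫ f w` for the `m`-measurable `w = μ[f|m] − g`. [folklore] -/
theorem integral_sub_condExp_sq_le_integral_sub_sq (hm : m ≤ m0) {f g : Ω → ℝ}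
    (hf : MemLp f 2 μ) (hg : MemLp g 2 μ) (hgm : StronglyMeasurable[m] g) :
    ∫ ω, (f ω - μ[f|m] ω) ^ 2 ∂μ ≤ ∫ ω, (f ω - g ω) ^ 2 ∂μ := by
  have hc : MemLp (μ[f|m]) 2 μ := hf.condExp one_le_two
  have hw : MemLp (fun ω => μ[f|m] ω - g ω) 2 μ := hc.sub hg
  have hwm : StronglyMeasurable[m] fun ω => μ[f|m] ω - g ω := stronglyMeasurable_condExp.sub hgm
  -- orthogonality of `f - μ[f|m]` to the `m`-measurable `μ[f|m] - g`
  have key : ∫ ω, μ[f|m] ω * (μ[f|m] ω - g ω) ∂μ = ∫ ω, f ω * (μ[f|m] ω - g ω) ∂μ :=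
    TwoBlock.integral_condExp_mul hm hf hw hwm
  have e : ∀ ω, (f ω - g ω) ^ 2 = ((f ω - μ[f|m] ω) ^ 2 + (μ[f|m] ω - g ω) ^ 2) +
      2 * (f ω * (μ[f|m] ω - g ω) - μ[f|m] ω * (μ[f|m] ω - g ω)) := fun ω => by ring
  have i1 : Integrable (fun ω => (f ω - μ[f|m] ω) ^ 2) μ := (hf.sub hc).integrable_sq
  have i2 : Integrable (fun ω => (μ[f|m] ω - g ω) ^ 2) μ := hw.integrable_sq
  have i3 : Integrable (fun ω => f ω * (μ[f|m] ω - g ω)) μ :=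
    TwoBlock.integrable_mul_of_memLp hf hw
  have i4 : Integrable (fun ω => μ[f|m] ω * (μ[f|m] ω - g ω)) μ :=
    TwoBlock.integrable_mul_of_memLp hc hw
  have i12 : Integrable (fun ω => (f ω - μ[f|m] ω) ^ 2 + (μ[f|m] ω - g ω) ^ 2) μ := i1.add i2
  have i34 : Integrable
      (fun ω => 2 * (f ω * (μ[f|m] ω - g ω) - μ[f|m] ω * (μ[f|m] ω - g ω))) μ :=
    (i3.sub i4).const_mul 2
  have hsum : ∫ ω, (f ω - g ω) ^ 2 ∂μ =
      ∫ ω, (f ω - μ[f|m] ω) ^ 2 ∂μ + ∫ ω, (μ[f|m] ω - g ω) ^ 2 ∂μ := by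
    simp_rw [e]
    rw [integral_add i12 i34, integral_add i1 i2, integral_const_mul, integral_sub i3 i4, key,
      sub_self, mul_zero, add_zero]
  rw [hsum]
  exact le_add_of_nonneg_right (integral_nonneg fun ω => sq_nonneg _)

end Projection

/-! ### Transfer along a measurable map with a coarser conditioning downstairs -/

/-- **Residual after conditioning upstairs vs. residual after conditioning downstairs.** Let
`π : Ω → X` be measurable, `P` a finite measure on `Ω`, `𝓗 ≤ mΩ` a sub-σ-algebra upstairs and
`𝓐 ≤ mX` one downstairs with `comap π 𝓐 ≤ 𝓗`. Then for bounded measurable `F : X → ℝ`: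
`∫ (F∘π − E_P[F∘π | 𝓗])² dP ≤ ∫ (F − E_{P∘π⁻¹}[F | 𝓐])² d(P∘π⁻¹)` — the function
`E_{P∘π⁻¹}[F | 𝓐] ∘ π` is `𝓗`-measurable, so the projection inequality applies, and the
resulting integral is transferred by `integral_map`. [folklore] -/
theorem integral_sub_condExp_comp_sq_le {Ω X : Type*} {𝓗 mΩ : MeasurableSpace Ω}
    {𝓐 mX : MeasurableSpace X} {P : Measure Ω} [IsFiniteMeasure P] {π : Ω → X}
    (hπ : Measurable π) (h𝓗 : 𝓗 ≤ mΩ) (h𝓐 : 𝓐 ≤ mX) (hle : 𝓐.comap π ≤ 𝓗)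
    {F : X → ℝ} (hF : Measurable F) {M : ℝ} (hM : ∀ x, |F x| ≤ M) :
    ∫ ω, (F (π ω) - P[F ∘ π|𝓗] ω) ^ 2 ∂P ≤
      ∫ x, (F x - ((P.map π)[F|𝓐]) x) ^ 2 ∂(P.map π) := by
  -- the `𝓗`-measurable approximant `(P.map π)[F|𝓐] ∘ π`
  have hhm : Measurable[𝓐] ((P.map π)[F|𝓐]) := stronglyMeasurable_condExp.measurable
  have hhm' : Measurable ((P.map π)[F|𝓐]) := hhm.mono h𝓐 le_rfl
  have hgm : StronglyMeasurable[𝓗] fun ω => ((P.map π)[F|𝓐]) (π ω) :=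
    (hhm.comp (Measurable.of_comap_le hle)).stronglyMeasurable
  have hf2 : MemLp (F ∘ π) 2 P :=
    MemLp.of_bound (hF.comp hπ).aestronglyMeasurable M
      (ae_of_all P fun ω => (Real.norm_eq_abs _).trans_le (hM (π ω)))
  have hbd : ∀ᵐ x ∂(P.map π), |((P.map π)[F|𝓐]) x| ≤ M :=
    ae_bdd_abs_condExp_of_ae_bdd_abs (ae_of_all _ hM)
  have hg2 : MemLp (fun ω => ((P.map π)[F|𝓐]) (π ω)) 2 P :=
    MemLp.of_bound (hhm'.comp hπ).aestronglyMeasurable M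
      ((ae_of_ae_map hπ.aemeasurable hbd).mono fun ω hω => (Real.norm_eq_abs _).trans_le hω)
  have hφ : AEStronglyMeasurable (fun x => (F x - ((P.map π)[F|𝓐]) x) ^ 2) (P.map π) :=
    ((hF.sub hhm').pow_const 2).aestronglyMeasurable
  calc ∫ ω, (F (π ω) - P[F ∘ π|𝓗] ω) ^ 2 ∂P
      ≤ ∫ ω, (F (π ω) - ((P.map π)[F|𝓐]) (π ω)) ^ 2 ∂P :=
        integral_sub_condExp_sq_le_integral_sub_sq h𝓗 hf2 hg2 hgm
    _ = ∫ x, (F x - ((P.map π)[F|𝓐]) x) ^ 2 ∂(P.map π) := (integral_map hπ.aemeasurable hφ).symm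

/-! ### Pinning one coordinate of the first factor of a product -/

/-- **The cylinder σ-algebra off `ℓ`, pulled back along `fst`, is contained in the pinned
σ-algebra** generated by `ω ↦ (ω.1[ℓ ↦ x], ω.2)`: each coordinate `ω ↦ ω.1 i`, `i ≠ ℓ`, factors
measurably through the pinning map since `(ω.1[ℓ ↦ x]) i = ω.1 i` (`Function.update_of_ne`).
[folklore] -/
theorem comap_fst_cylinderEvents_le {ι G Y : Type*} [MeasurableSpace G] [MeasurableSpace Y]
    [DecidableEq ι] (ℓ : ι) (x : G) {Δ : Set ι} (hΔ : ℓ ∉ Δ) :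
    (cylinderEvents Δ).comap (Prod.fst : (ι → G) × Y → ι → G) ≤
      MeasurableSpace.comap (fun ω : (ι → G) × Y => (Function.update ω.1 ℓ x, ω.2))
        inferInstance := by
  refine Measurable.comap_le (measurable_cylinderEvents_iff.2 fun i hi => ?_)
  have hne : i ≠ ℓ := fun h => hΔ (h ▸ hi)
  have heq : (fun ω : (ι → G) × Y => ω.1 i) =
      (fun ω : (ι → G) × Y => ω.1 i) ∘
        fun ω : (ι → G) × Y => (Function.update ω.1 ℓ x, ω.2) := by
    funext ω
    exact (Function.update_of_ne hne x ω.1).symm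
  rw [heq]
  exact ((measurable_pi_apply i).comp measurable_fst).comp (comap_measurable _)

/-- **Pinned single-coordinate residual vs. residual given the other coordinates downstairs.**
For a finite measure `P` on `(ι → G) × Y`, a coordinate `ℓ`, a pin value `x` and a bounded
measurable `F : (ι → G) → ℝ`:
`∫ (F∘fst − E_P[F∘fst | σ(ω ↦ (ω.1[ℓ ↦ x], ω.2))])² dP
  ≤ ∫ (F − E_{P₁}[F | cylinderEvents {ℓ}ᶜ])² dP₁`,
`P₁ = P.map fst` (`integral_sub_condExp_comp_sq_le` with `comap_fst_cylinderEvents_le`).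
[folklore] -/
theorem integral_sub_condExp_pinned_sq_le {ι G Y : Type*} [MeasurableSpace G]
    [MeasurableSpace Y] [DecidableEq ι] {P : Measure ((ι → G) × Y)} [IsFiniteMeasure P]
    (ℓ : ι) (x : G) {F : (ι → G) → ℝ} (hF : Measurable F) {M : ℝ} (hM : ∀ U, |F U| ≤ M) :
    ∫ ω, (F ω.1 - P[F ∘ Prod.fst|MeasurableSpace.comap
        (fun ω' : (ι → G) × Y => (Function.update ω'.1 ℓ x, ω'.2)) inferInstance] ω) ^ 2 ∂P ≤
      ∫ U, (F U - ((P.map Prod.fst)[F|cylinderEvents ((↑({ℓ} : Finset ι) : Set ι)ᶜ)]) U) ^ 2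
        ∂(P.map Prod.fst) := by
  have hR : Measurable fun ω' : (ι → G) × Y => (Function.update ω'.1 ℓ x, ω'.2) :=
    (measurable_update_left.comp measurable_fst).prodMk measurable_snd
  have hℓ : ℓ ∉ ((↑({ℓ} : Finset ι) : Set ι)ᶜ) := by simp
  exact integral_sub_condExp_comp_sq_le measurable_fst hR.comap_le cylinderEvents_le_pi
    (comap_fst_cylinderEvents_le ℓ x hℓ) hF hM

end PinnedGlauber

/-! ### The registered rider -/

/-- `stub_pinnedGlauber_le_heatBath` — **rider R_B of the line `rg-variance-cascade`: the pinned
single-link conditional variances of the joint law are dominated by the Wilson heat-bath form.**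
For every compact `G`, `r`, real `β` there is `C = C(G, r, β) ≥ 0` (namely `C = A · B` with the
constants of `stub_linkSetPoincare`) such that for every block base `b ≥ 1`, `n`, `s`, side
`2S+1`, the joint law `P` of the fine Wilson field and its smeared block fields, and every bounded
measurable `F`:
`Σ_ℓ ∫ (F∘fst − E_P[F∘fst | σ(U_{ℓ'} (ℓ' ≠ ℓ), V)])² dP
  ≤ C · Σ_ℓ ∫∫ (F U − F(U[ℓ ↦ g]))² dν_ℓ^U(g) dμ(U)`.
Proof: per link, the pinned σ-algebra `𝓗_ℓ = comap (ω ↦ (U[ℓ ↦ 1], V))` contains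
`comap fst (cylinderEvents {ℓ}ᶜ)`, so the `L²(P)`-residual of `F∘fst` after projecting on `𝓗_ℓ`
is at most its distance to `E_μ[F | cylinderEvents {ℓ}ᶜ] ∘ fst`, which equals
`∫ (F − E_μ[F | cylinderEvents {ℓ}ᶜ])² dμ` because `P.map fst = μ` (`stub_jointMarginal`,
`PinnedGlauber.integral_sub_condExp_pinned_sq_le`); the latter is `≤ A · B · hb_ℓ(F)` by
`stub_linkSetPoincare` with `D = {ℓ}`; sum over `ℓ`. [folklore] -/
theorem stub_pinnedGlauber_le_heatBath :
    ∀ (G : Type) [Group G] [TopologicalSpace G] [IsTopologicalGroup G] [CompactSpace G]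
      [MeasurableSpace G] [BorelSpace G] (r : LatticeRep G) (β : ℝ), ∃ C : ℝ, 0 ≤ C ∧
      ∀ (b : ℕ) [NeZero b] (n : ℕ) (s : ℝ) (S : ℕ)
      (P : Measure (GaugeConfig 4 (2 * S + 1) G ×
          ((k : Fin n) → GaugeConfig 4 (BalabanAveraging.blockSide (2 * S + 1) (b ^ ((k : ℕ) + 1))) G))),
      P = ((wilsonMeasure r.ρ β : Measure (GaugeConfig 4 (2 * S + 1) G)).prod
          (Measure.pi fun k : Fin n => Measure.pi
            fun _ : Edge 4 (BalabanAveraging.blockSide (2 * S + 1) (b ^ ((k : ℕ) + 1))) => haarProbability G)).tilted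
          (fun ω => ∑ k : Fin n, ∑ e : Edge 4 (BalabanAveraging.blockSide (2 * S + 1) (b ^ ((k : ℕ) + 1))),
            s * (r.ρ (ω.2 k e * (BalabanAveraging.link (2 * S + 1) (b ^ ((k : ℕ) + 1))
              (BalabanAveraging.BlockMean.rep 0) ω.1 e)⁻¹)).trace.re) →
      ∀ (F : GaugeConfig 4 (2 * S + 1) G → ℝ), Measurable F → (∃ M : ℝ, ∀ U, |F U| ≤ M) →
      ∑ ℓ : Edge 4 (2 * S + 1), ∫ ω, (F ω.1 - condExp (MeasurableSpace.comap
          (fun ω' : GaugeConfig 4 (2 * S + 1) G ×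
            ((k : Fin n) → GaugeConfig 4 (BalabanAveraging.blockSide (2 * S + 1) (b ^ ((k : ℕ) + 1))) G) =>
            (Function.update ω'.1 ℓ 1, ω'.2)) inferInstance) P (F ∘ Prod.fst) ω) ^ 2 ∂P ≤
      C * ∑ ℓ : Edge 4 (2 * S + 1), ∫ U, ∫ g, (F U - F (Function.update U ℓ g)) ^ 2
          ∂((haarProbability G).tilted (fun g' => -β * wilsonAction r.ρ (Function.update U ℓ g')))
          ∂(wilsonMeasure r.ρ β : Measure (GaugeConfig 4 (2 * S + 1) G)) := by
  intro G _ _ _ _ _ _ r β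
  obtain ⟨A, B, hA, hB, hLS⟩ := stub_linkSetPoincare G r β
  refine ⟨A * B, mul_nonneg hA (zero_le_one.trans hB), ?_⟩
  intro b _ n s S P hP F hF hbd
  obtain ⟨M, hM⟩ := hbd
  obtain ⟨hprob, hmap⟩ := stub_jointMarginal G r β b n s S P hP
  haveI : IsProbabilityMeasure P := hprob
  rw [Finset.mul_sum]
  refine Finset.sum_le_sum fun ℓ _ => ?_
  -- the single-link local Poincaré inequality of the Wilson measure (`D = {ℓ}`)
  have h1 := hLS S _ rfl {ℓ} F hF ⟨M, hM⟩
  rw [Finset.card_singleton, pow_one, Finset.sum_singleton] at h1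
  refine le_trans ?_ h1
  -- pinned residual upstairs ≤ residual given the links off `ℓ` downstairs, along `P.map fst = μ`
  rw [← hmap]
  exact PinnedGlauber.integral_sub_condExp_pinned_sq_le ℓ 1 hF hM

end Summit.QuantumFields.YangMills.Theorems.SusceptibilityToPoincare.RgVarianceCascade

end
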